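import Mathlib.Analysis.MeanInequalities
import Literature.Analysis.FunctionSpaces.TorusFourierCalculus
import Literature.Analysis.FunctionSpaces.TorusSpectralWeakDerivative
import Literature.Analysis.FunctionSpaces.TorusSobolevNormFacts
import Literature.Analysis.FunctionSpaces.TorusInverseLaplacianL2
import HarnessLib

/-!
# A weighted one-directional integration-by-parts band inequality for Fourier coefficients on `T^d`
# `√(Σ_{|kᵢ| ≤ L} ‖𝓕a(k)‖²) ≤ ‖(1 − w p) a‖₂ + (2π)⁻¹ ‖c ∂ᵢw‖₂ + L ‖w c‖₂`   whenever `∂ᵢc = −2π p a`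

Topic `Literature/Analysis/Fourier`; namespace `Literature.Analysis.Fourier`.  Analysis/Fourier support file (everything
proved; no definitions, no named facts).  The "non-stationary phase" principle — integrate by parts once where the phase
derivative is large [cite: Grafakos2014, Prop. 3.2.6 (8) (`𝓕(∂ⱼf)(m) = 2πi mⱼ 𝓕f(m)`)] — in an `L²`/Bessel form on the
flat torus, in ONE coordinate direction `i` and with an ARBITRARY smooth real weight `w`.  The model case is
`a = sin (2πφ)`, `c = cos (2πφ)`, `p = ∂ᵢφ` for a (possibly circle-valued) phase `φ`, where `∂ᵢc = −2π p a`; only this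
relation and smoothness are used, so the statements are phrased for four smooth real functions `a, c, p, w`:

* `mFourierCoeff_ofReal_mul_partialDeriv` — `𝓕(w ∂ᵢc)(k) = 2πi kᵢ 𝓕(w c)(k) − 𝓕(c ∂ᵢw)(k)` (Leibniz + derivative rule);
* `mFourierCoeff_ofReal_eq_weighted_ibp` — `𝓕a(k) = 𝓕((1 − w p) a)(k) + (2π)⁻¹ 𝓕(c ∂ᵢw)(k) − i kᵢ 𝓕(w c)(k)`;
* `norm_mFourierCoeff_ofReal_le_weighted_ibp` — `‖𝓕a(k)‖ ≤ ‖𝓕((1 − w p)a)(k)‖ + (2π)⁻¹‖𝓕(c ∂ᵢw)(k)‖ + |kᵢ| ‖𝓕(w c)(k)‖`;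
* `tsum_symbol_mul_sq_norm_mFourierCoeff_le_integral_sq` — Bessel for a real symbol `0 ≤ χ ≤ 1`:
  `Σ' χ(k)‖𝓕f(k)‖² ≤ ∫ f²` [cite: Grafakos2014, Prop. 3.2.7 (3) (Parseval)];
* **`tsum_band_sq_norm_mFourierCoeff_le_weighted_ibp`** — for every real symbol `0 ≤ χ ≤ 1` vanishing off the band
  `|kᵢ| ≤ L`: `Σ' χ(k) ‖𝓕a(k)‖² ≤ 3 (∫((1 − w p) a)² + (2π)⁻² ∫(c ∂ᵢw)² + L² ∫(w c)²)`;
* **`sqrt_tsum_band_sq_norm_mFourierCoeff_le_weighted_ibp`** — the sharp (Minkowski) form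
  `√(Σ' χ(k) ‖𝓕a(k)‖²) ≤ √∫((1 − w p) a)² + (2π)⁻¹ √∫(c ∂ᵢw)² + L √∫(w c)²` (`0 ≤ L`).

* `partialDeriv_eq_of_sq_add_sq_eq_one`, `sqrt_tsum_band_sq_norm_mFourierCoeff_le_of_pair` (§4) — for a unit-circle pair
  `a² + c² = 1` the phase derivative `p = (c ∂ᵢa − a ∂ᵢc)/(2π)` satisfies `∂ᵢc = −2πpa`, `∂ᵢa = 2πpc`, so the inequality needs no
  lift of a circle-valued phase.

Typical use: `w = ψ/p` with a cut-off `ψ` supported where `|p|` is large (sublevel + chirp + `L‖ψ/p‖` terms). All proved, no definitions.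
-/

noncomputable section

namespace Literature.Analysis.Fourier

open MeasureTheory Set Filter UnitAddTorus Complex
open _root_.Topology
open Literature.Analysis.FunctionSpaces Literature.Analysis.FunctionSpaces.Torus

variable {d : Type*} [Fintype d] [DecidableEq d]

/-! ## §1 Leibniz under the Fourier coefficient -/

/-- **`𝓕(w ∂ᵢc)(k) = 2πi kᵢ 𝓕(w c)(k) − 𝓕(c ∂ᵢw)(k)`** for smooth real `w, c` on `T^d` (Leibniz rule and the
derivative rule for Fourier coefficients). [cite: Grafakos2014, Prop. 3.2.6 (8)] -/
theorem mFourierCoeff_ofReal_mul_partialDeriv {w c : UnitAddTorus d → ℝ} (hw : IsSmooth w) (hc : IsSmooth c)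
    (i : d) (k : d → ℤ) :
    mFourierCoeff (fun x => ((w x * partialDeriv i c x : ℝ) : ℂ)) k =
      (2 * Real.pi * Complex.I * (k i : ℂ)) * mFourierCoeff (fun x => ((w x * c x : ℝ) : ℂ)) k -
        mFourierCoeff (fun x => ((c x * partialDeriv i w x : ℝ) : ℂ)) k := by
  have hwc : IsSmooth (fun x => w x * c x) := hw.smul' hc
  -- Leibniz: `w ∂ᵢc = ∂ᵢ(w c) − c ∂ᵢw`
  have hleib : ∀ x, w x * partialDeriv i c x =
      partialDeriv i (fun y => w y * c y) x - c x * partialDeriv i w x := by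
    intro x
    have h := partialDeriv_smul (hw.isContDiff (by simp)) (hc.isContDiff (by simp)) i x
    simp only [smul_eq_mul] at h
    rw [h]; ring
  -- derivative rule `𝓕(∂ᵢ(w c))(k) = 2πi kᵢ 𝓕(w c)(k)` (complexified)
  have hderiv : mFourierCoeff (fun x => ((partialDeriv i (fun y => w y * c y) x : ℝ) : ℂ)) k =
      (2 * Real.pi * Complex.I * (k i : ℂ)) * mFourierCoeff (fun x => ((w x * c x : ℝ) : ℂ)) k := by
    have h := Torus.mFourierCoeff_partialDeriv hwc.ofReal_comp i k
    rw [funext fun x => partialDeriv_ofReal_comp hwc i x] at h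
    rw [h, smul_eq_mul]
  have hint1 : Integrable (fun x => ((w x * partialDeriv i c x : ℝ) : ℂ)) volume :=
    ((hw.smul' (hc.partialDeriv i)).ofReal_comp).integrable
  have hint2 : Integrable (fun x => ((c x * partialDeriv i w x : ℝ) : ℂ)) volume :=
    ((hc.smul' (hw.partialDeriv i)).ofReal_comp).integrable
  -- `𝓕(w ∂ᵢc) + 𝓕(c ∂ᵢw) = 𝓕(∂ᵢ(w c))`
  have hadd := Torus.mFourierCoeff_add hint1 hint2 k
  have hfun : ((fun x => ((w x * partialDeriv i c x : ℝ) : ℂ)) + fun x => ((c x * partialDeriv i w x : ℝ) : ℂ)) =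
      fun x => ((partialDeriv i (fun y => w y * c y) x : ℝ) : ℂ) := by
    funext x
    simp only [Pi.add_apply]
    rw [hleib x]; push_cast; ring
  rw [hfun, hderiv] at hadd
  rw [hadd]
  ring

/-! ## §2 The weighted decomposition of `𝓕a(k)` and the pointwise bound -/

/-- **Weighted decomposition**: if `∂ᵢc = −2π p a` then for every smooth weight `w`,
`𝓕a(k) = 𝓕((1 − w p) a)(k) + (2π)⁻¹ 𝓕(c ∂ᵢw)(k) − i kᵢ 𝓕(w c)(k)`. [cite: Grafakos2014, Prop. 3.2.6 (8)] -/
theorem mFourierCoeff_ofReal_eq_weighted_ibp {a c p w : UnitAddTorus d → ℝ} (ha : IsSmooth a)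
    (hc : IsSmooth c) (hp : IsSmooth p) (hw : IsSmooth w) (i : d)
    (hrel : ∀ x, partialDeriv i c x = -(2 * Real.pi) * (p x * a x)) (k : d → ℤ) :
    mFourierCoeff (fun x => (a x : ℂ)) k =
      mFourierCoeff (fun x => (((1 - w x * p x) * a x : ℝ) : ℂ)) k +
        (1 / (2 * Real.pi) : ℂ) * mFourierCoeff (fun x => ((c x * partialDeriv i w x : ℝ) : ℂ)) k -
          (Complex.I * (k i : ℂ)) * mFourierCoeff (fun x => ((w x * c x : ℝ) : ℂ)) k := by
  have hπ : (2 * Real.pi : ℂ) ≠ 0 := by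
    exact_mod_cast (ne_of_gt (by positivity : (0 : ℝ) < 2 * Real.pi))
  -- `a = (1 − w p) a − (2π)⁻¹ · w ∂ᵢc` pointwise
  have hsplit : (fun x => (a x : ℂ)) = fun x =>
      (((1 - w x * p x) * a x : ℝ) : ℂ) + (-(1 / (2 * Real.pi) : ℂ)) * ((w x * partialDeriv i c x : ℝ) : ℂ) := by
    funext x
    rw [hrel x]; push_cast
    field_simp
    ring
  have hint1 : Integrable (fun x => (((1 - w x * p x) * a x : ℝ) : ℂ)) volume :=
    ((((isSmooth_const (1 : ℝ)).sub (hw.smul' hp)).smul' ha).ofReal_comp).integrable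
  have hint2 : Integrable (fun x => (-(1 / (2 * Real.pi) : ℂ)) * ((w x * partialDeriv i c x : ℝ) : ℂ)) volume :=
    (((hw.smul' (hc.partialDeriv i)).ofReal_comp).integrable).const_mul _
  have hadd := Torus.mFourierCoeff_add hint1 hint2 k
  have hcm : mFourierCoeff (fun x => (-(1 / (2 * Real.pi) : ℂ)) * ((w x * partialDeriv i c x : ℝ) : ℂ)) k =
      (-(1 / (2 * Real.pi) : ℂ)) * mFourierCoeff (fun x => ((w x * partialDeriv i c x : ℝ) : ℂ)) k := by
    simp only [Torus.mFourierCoeff_eq_integral_volume, smul_eq_mul, ← integral_const_mul]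
    congr 1 with x
    ring
  rw [hsplit]
  rw [show (fun x => (((1 - w x * p x) * a x : ℝ) : ℂ) + (-(1 / (2 * Real.pi) : ℂ)) * ((w x * partialDeriv i c x : ℝ) : ℂ)) =
      (fun x => (((1 - w x * p x) * a x : ℝ) : ℂ)) + fun x => (-(1 / (2 * Real.pi) : ℂ)) * ((w x * partialDeriv i c x : ℝ) : ℂ)
    from rfl]
  rw [hadd, hcm, mFourierCoeff_ofReal_mul_partialDeriv hw hc i k]
  field_simp
  ring

/-- **Pointwise bound**: `‖𝓕a(k)‖ ≤ ‖𝓕((1 − w p)a)(k)‖ + (2π)⁻¹ ‖𝓕(c ∂ᵢw)(k)‖ + |kᵢ| ‖𝓕(w c)(k)‖`.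
[cite: Grafakos2014, Prop. 3.2.6 (8)] -/
theorem norm_mFourierCoeff_ofReal_le_weighted_ibp {a c p w : UnitAddTorus d → ℝ} (ha : IsSmooth a)
    (hc : IsSmooth c) (hp : IsSmooth p) (hw : IsSmooth w) (i : d)
    (hrel : ∀ x, partialDeriv i c x = -(2 * Real.pi) * (p x * a x)) (k : d → ℤ) :
    ‖mFourierCoeff (fun x => (a x : ℂ)) k‖ ≤
      ‖mFourierCoeff (fun x => (((1 - w x * p x) * a x : ℝ) : ℂ)) k‖ +
        1 / (2 * Real.pi) * ‖mFourierCoeff (fun x => ((c x * partialDeriv i w x : ℝ) : ℂ)) k‖ +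
          |(k i : ℝ)| * ‖mFourierCoeff (fun x => ((w x * c x : ℝ) : ℂ)) k‖ := by
  rw [mFourierCoeff_ofReal_eq_weighted_ibp ha hc hp hw i hrel k]
  have hπ0 : 0 < 2 * Real.pi := by positivity
  refine (norm_sub_le _ _).trans ?_
  refine add_le_add ((norm_add_le _ _).trans (add_le_add le_rfl ?_)) ?_
  · rw [norm_mul]
    gcongr
    rw [show (1 / (2 * Real.pi) : ℂ) = ((1 / (2 * Real.pi) : ℝ) : ℂ) by push_cast; ring, Complex.norm_real,
      Real.norm_of_nonneg (by positivity)]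
  · rw [norm_mul, norm_mul, Complex.norm_I, one_mul, Complex.norm_intCast]

/-! ## §3 The band inequality (Bessel ≤ Parseval termwise) -/

/-- Minkowski in `ℓ²(ι)` for two square-summable nonnegative families, `√`-form (Mathlib's
`Real.Lp_add_le_tsum_of_nonneg` at `p = 2`). [folklore] -/
private theorem sqrt_tsum_add_sq_le_add {ι : Type*} {u v : ι → ℝ} (hu0 : ∀ k, 0 ≤ u k) (hv0 : ∀ k, 0 ≤ v k)
    (hu : Summable fun k => u k ^ 2) (hv : Summable fun k => v k ^ 2) :
    (Summable fun k => (u k + v k) ^ 2) ∧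
      Real.sqrt (∑' k, (u k + v k) ^ 2) ≤ Real.sqrt (∑' k, u k ^ 2) + Real.sqrt (∑' k, v k ^ 2) := by
  have hu' : Summable fun k => u k ^ (2 : ℝ) := by simpa [Real.rpow_two] using hu
  have hv' : Summable fun k => v k ^ (2 : ℝ) := by simpa [Real.rpow_two] using hv
  have h := Real.Lp_add_le_tsum_of_nonneg (p := 2) (by norm_num) hu0 hv0 hu' hv'
  simp only [Real.rpow_two] at h
  refine ⟨h.1, ?_⟩
  simpa [Real.sqrt_eq_rpow] using h.2

omit [DecidableEq d] in
/-- Bessel: for a real symbol `0 ≤ χ ≤ 1`, `Σ' χ(k) ‖𝓕f(k)‖² ≤ ‖f‖²_{L²}` for continuous real `f`.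
[cite: Grafakos2014, Prop. 3.2.7 (3) (Parseval)] -/
theorem tsum_symbol_mul_sq_norm_mFourierCoeff_le_integral_sq {f : UnitAddTorus d → ℝ} (hf : Continuous f) {χ : (d → ℤ) → ℝ}
    (hχ0 : ∀ k, 0 ≤ χ k) (hχ1 : ∀ k, χ k ≤ 1) :
    ∑' k, χ k * ‖mFourierCoeff (fun x => (f x : ℂ)) k‖ ^ 2 ≤ (∫ x, f x ^ 2) := by
  have hP := Torus.hasSum_sq_mFourierCoeff_ofReal hf
  have hle : ∀ k, χ k * ‖mFourierCoeff (fun x => (f x : ℂ)) k‖ ^ 2 ≤ ‖mFourierCoeff (fun x => (f x : ℂ)) k‖ ^ 2 :=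
    fun k => by nlinarith [hχ1 k, sq_nonneg ‖mFourierCoeff (fun x => (f x : ℂ)) k‖]
  have hsum : Summable fun k => χ k * ‖mFourierCoeff (fun x => (f x : ℂ)) k‖ ^ 2 :=
    Summable.of_nonneg_of_le (fun k => mul_nonneg (hχ0 k) (sq_nonneg _)) hle hP.summable
  calc ∑' k, χ k * ‖mFourierCoeff (fun x => (f x : ℂ)) k‖ ^ 2
      ≤ ∑' k, ‖mFourierCoeff (fun x => (f x : ℂ)) k‖ ^ 2 := hsum.tsum_le_tsum hle hP.summable
    _ = (∫ x, f x ^ 2) := hP.tsum_eq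

/-- **The weighted one-directional band inequality.**  Let `a, c, p, w` be smooth real functions on `T^d` with
`∂ᵢc = −2π p a`, and `χ` a real symbol with `0 ≤ χ ≤ 1` and `χ(k) = 0` unless `|kᵢ| ≤ L` (`L` real).  Then
`Σ' χ(k) ‖𝓕a(k)‖² ≤ 3 (‖(1 − w p) a‖² + (2π)⁻² ‖c ∂ᵢw‖² + L² ‖w c‖²)` (squared `L²` norms as `∫ (·)²`).
[cite: Grafakos2014, Prop. 3.2.6 (8) and Prop. 3.2.7 (3)] -/
theorem tsum_band_sq_norm_mFourierCoeff_le_weighted_ibp {a c p w : UnitAddTorus d → ℝ} (ha : IsSmooth a)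
    (hc : IsSmooth c) (hp : IsSmooth p) (hw : IsSmooth w) (i : d)
    (hrel : ∀ x, partialDeriv i c x = -(2 * Real.pi) * (p x * a x)) {L : ℝ}
    {χ : (d → ℤ) → ℝ} (hχ0 : ∀ k, 0 ≤ χ k) (hχ1 : ∀ k, χ k ≤ 1) (hχL : ∀ k, L < |(k i : ℝ)| → χ k = 0) :
    ∑' k, χ k * ‖mFourierCoeff (fun x => (a x : ℂ)) k‖ ^ 2 ≤
      3 * ((∫ x, ((1 - w x * p x) * a x) ^ 2) +
        (1 / (2 * Real.pi)) ^ 2 * (∫ x, (c x * partialDeriv i w x) ^ 2) +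
          L ^ 2 * (∫ x, (w x * c x) ^ 2)) := by
  -- the three comparison functions
  set f₁ : UnitAddTorus d → ℝ := fun x => (1 - w x * p x) * a x with hf₁
  set f₂ : UnitAddTorus d → ℝ := fun x => c x * partialDeriv i w x with hf₂
  set f₃ : UnitAddTorus d → ℝ := fun x => w x * c x with hf₃
  have hf₁c : Continuous f₁ := (((isSmooth_const (1 : ℝ)).sub (hw.smul' hp)).smul' ha).continuous
  have hf₂c : Continuous f₂ := (hc.smul' (hw.partialDeriv i)).continuous
  have hf₃c : Continuous f₃ := (hw.smul' hc).continuous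
  set A : (d → ℤ) → ℝ := fun k => ‖mFourierCoeff (fun x => (f₁ x : ℂ)) k‖ with hA
  set B : (d → ℤ) → ℝ := fun k => ‖mFourierCoeff (fun x => (f₂ x : ℂ)) k‖ with hB
  set C : (d → ℤ) → ℝ := fun k => ‖mFourierCoeff (fun x => (f₃ x : ℂ)) k‖ with hC
  have hπ0 : 0 < 2 * Real.pi := by positivity
  -- termwise: `χ‖𝓕a‖² ≤ 3 (χ A² + (2π)⁻² χ B² + L² χ C²)`
  have hterm : ∀ k, χ k * ‖mFourierCoeff (fun x => (a x : ℂ)) k‖ ^ 2 ≤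
      3 * (χ k * A k ^ 2 + (1 / (2 * Real.pi)) ^ 2 * (χ k * B k ^ 2) + L ^ 2 * (χ k * C k ^ 2)) := by
    intro k
    have hpt := norm_mFourierCoeff_ofReal_le_weighted_ibp ha hc hp hw i hrel k
    by_cases hk : L < |(k i : ℝ)|
    · rw [hχL k hk]; simp
    · push Not at hk
      have hki : |(k i : ℝ)| * C k ≤ L * C k := mul_le_mul_of_nonneg_right hk (norm_nonneg _)
      have h3 : ‖mFourierCoeff (fun x => (a x : ℂ)) k‖ ≤ A k + 1 / (2 * Real.pi) * B k + L * C k := by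
        refine hpt.trans ?_
        simp only [hA, hB, hC, hf₁, hf₂, hf₃]
        linarith
      have hn : 0 ≤ ‖mFourierCoeff (fun x => (a x : ℂ)) k‖ := norm_nonneg _
      have hsq : ‖mFourierCoeff (fun x => (a x : ℂ)) k‖ ^ 2 ≤ (A k + 1 / (2 * Real.pi) * B k + L * C k) ^ 2 :=
        pow_le_pow_left₀ hn h3 2
      have hcs : (A k + 1 / (2 * Real.pi) * B k + L * C k) ^ 2 ≤
          3 * (A k ^ 2 + (1 / (2 * Real.pi)) ^ 2 * B k ^ 2 + L ^ 2 * C k ^ 2) := by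
        nlinarith [sq_nonneg (A k - 1 / (2 * Real.pi) * B k), sq_nonneg (A k - L * C k),
          sq_nonneg (1 / (2 * Real.pi) * B k - L * C k)]
      have := mul_le_mul_of_nonneg_left (hsq.trans hcs) (hχ0 k)
      linarith [this]
  -- summability of the three majorants (each `≤ ‖𝓕fⱼ‖²`, Parseval)
  have hsA : Summable fun k => χ k * A k ^ 2 :=
    Summable.of_nonneg_of_le (fun k => mul_nonneg (hχ0 k) (sq_nonneg _))
      (fun k => by nlinarith [hχ1 k, hχ0 k, sq_nonneg (A k)])
      (Torus.hasSum_sq_mFourierCoeff_ofReal hf₁c).summable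
  have hsB : Summable fun k => χ k * B k ^ 2 :=
    Summable.of_nonneg_of_le (fun k => mul_nonneg (hχ0 k) (sq_nonneg _))
      (fun k => by nlinarith [hχ1 k, hχ0 k, sq_nonneg (B k)])
      (Torus.hasSum_sq_mFourierCoeff_ofReal hf₂c).summable
  have hsC : Summable fun k => χ k * C k ^ 2 :=
    Summable.of_nonneg_of_le (fun k => mul_nonneg (hχ0 k) (sq_nonneg _))
      (fun k => by nlinarith [hχ1 k, hχ0 k, sq_nonneg (C k)])
      (Torus.hasSum_sq_mFourierCoeff_ofReal hf₃c).summable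
  have hsR : Summable fun k =>
      3 * (χ k * A k ^ 2 + (1 / (2 * Real.pi)) ^ 2 * (χ k * B k ^ 2) + L ^ 2 * (χ k * C k ^ 2)) :=
    ((hsA.add (hsB.mul_left _)).add (hsC.mul_left _)).mul_left 3
  have hsL : Summable fun k => χ k * ‖mFourierCoeff (fun x => (a x : ℂ)) k‖ ^ 2 :=
    Summable.of_nonneg_of_le (fun k => mul_nonneg (hχ0 k) (sq_nonneg _)) hterm hsR
  calc ∑' k, χ k * ‖mFourierCoeff (fun x => (a x : ℂ)) k‖ ^ 2
      ≤ ∑' k, 3 * (χ k * A k ^ 2 + (1 / (2 * Real.pi)) ^ 2 * (χ k * B k ^ 2) + L ^ 2 * (χ k * C k ^ 2)) :=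
        hsL.tsum_le_tsum hterm hsR
    _ = 3 * (∑' k, χ k * A k ^ 2 + (1 / (2 * Real.pi)) ^ 2 * ∑' k, χ k * B k ^ 2 + L ^ 2 * ∑' k, χ k * C k ^ 2) := by
        rw [tsum_mul_left, ((hsA.add (hsB.mul_left _)).tsum_add (hsC.mul_left _)), hsA.tsum_add (hsB.mul_left _),
          tsum_mul_left, tsum_mul_left]
    _ ≤ 3 * ((∫ x, f₁ x ^ 2) + (1 / (2 * Real.pi)) ^ 2 * (∫ x, f₂ x ^ 2) +
          L ^ 2 * (∫ x, f₃ x ^ 2)) := by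
        gcongr
        · exact tsum_symbol_mul_sq_norm_mFourierCoeff_le_integral_sq hf₁c hχ0 hχ1
        · exact tsum_symbol_mul_sq_norm_mFourierCoeff_le_integral_sq hf₂c hχ0 hχ1
        · exact tsum_symbol_mul_sq_norm_mFourierCoeff_le_integral_sq hf₃c hχ0 hχ1

/-- **The weighted one-directional band inequality, sharp (Minkowski) form.**  Under the hypotheses of
`tsum_band_sq_norm_mFourierCoeff_le_weighted_ibp` and `0 ≤ L`:
`√(Σ' χ(k) ‖𝓕a(k)‖²) ≤ √‖(1 − w p) a‖² + (2π)⁻¹ √‖c ∂ᵢw‖² + L √‖w c‖²` .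
[cite: Grafakos2014, Prop. 3.2.6 (8) and Prop. 3.2.7 (3)] -/
theorem sqrt_tsum_band_sq_norm_mFourierCoeff_le_weighted_ibp {a c p w : UnitAddTorus d → ℝ} (ha : IsSmooth a)
    (hc : IsSmooth c) (hp : IsSmooth p) (hw : IsSmooth w) (i : d)
    (hrel : ∀ x, partialDeriv i c x = -(2 * Real.pi) * (p x * a x)) {L : ℝ} (hL : 0 ≤ L)
    {χ : (d → ℤ) → ℝ} (hχ0 : ∀ k, 0 ≤ χ k) (hχ1 : ∀ k, χ k ≤ 1) (hχL : ∀ k, L < |(k i : ℝ)| → χ k = 0) :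
    Real.sqrt (∑' k, χ k * ‖mFourierCoeff (fun x => (a x : ℂ)) k‖ ^ 2) ≤
      Real.sqrt ((∫ x, ((1 - w x * p x) * a x) ^ 2)) +
        1 / (2 * Real.pi) * Real.sqrt ((∫ x, (c x * partialDeriv i w x) ^ 2)) +
          L * Real.sqrt ((∫ x, (w x * c x) ^ 2)) := by
  set f₁ : UnitAddTorus d → ℝ := fun x => (1 - w x * p x) * a x with hf₁
  set f₂ : UnitAddTorus d → ℝ := fun x => c x * partialDeriv i w x with hf₂
  set f₃ : UnitAddTorus d → ℝ := fun x => w x * c x with hf₃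
  have hf₁c : Continuous f₁ := (((isSmooth_const (1 : ℝ)).sub (hw.smul' hp)).smul' ha).continuous
  have hf₂c : Continuous f₂ := (hc.smul' (hw.partialDeriv i)).continuous
  have hf₃c : Continuous f₃ := (hw.smul' hc).continuous
  have hπ0 : 0 < 2 * Real.pi := by positivity
  have hπ' : 0 ≤ 1 / (2 * Real.pi) := by positivity
  -- the square-root weights and the three majorant families
  set r : (d → ℤ) → ℝ := fun k => Real.sqrt (χ k) with hr
  have hr0 : ∀ k, 0 ≤ r k := fun k => Real.sqrt_nonneg _
  have hr2 : ∀ k, r k ^ 2 = χ k := fun k => Real.sq_sqrt (hχ0 k)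
  set u : (d → ℤ) → ℝ := fun k => r k * ‖mFourierCoeff (fun x => (a x : ℂ)) k‖ with hu
  set U₁ : (d → ℤ) → ℝ := fun k => r k * ‖mFourierCoeff (fun x => (f₁ x : ℂ)) k‖ with hU₁
  set U₂ : (d → ℤ) → ℝ := fun k => r k * (1 / (2 * Real.pi) * ‖mFourierCoeff (fun x => (f₂ x : ℂ)) k‖) with hU₂
  set U₃ : (d → ℤ) → ℝ := fun k => r k * (L * ‖mFourierCoeff (fun x => (f₃ x : ℂ)) k‖) with hU₃
  have hu0 : ∀ k, 0 ≤ u k := fun k => mul_nonneg (hr0 k) (norm_nonneg _)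
  have hU₁0 : ∀ k, 0 ≤ U₁ k := fun k => mul_nonneg (hr0 k) (norm_nonneg _)
  have hU₂0 : ∀ k, 0 ≤ U₂ k := fun k => mul_nonneg (hr0 k) (mul_nonneg hπ' (norm_nonneg _))
  have hU₃0 : ∀ k, 0 ≤ U₃ k := fun k => mul_nonneg (hr0 k) (mul_nonneg hL (norm_nonneg _))
  -- pointwise domination `u ≤ U₁ + (U₂ + U₃)`
  have hdom : ∀ k, u k ≤ U₁ k + (U₂ k + U₃ k) := by
    intro k
    by_cases hk : L < |(k i : ℝ)|
    · have h0 : r k = 0 := by rw [hr]; simp [hχL k hk]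
      simp [hu, hU₁, hU₂, hU₃, h0]
    · push Not at hk
      have hpt := norm_mFourierCoeff_ofReal_le_weighted_ibp ha hc hp hw i hrel k
      have hki : |(k i : ℝ)| * ‖mFourierCoeff (fun x => (f₃ x : ℂ)) k‖ ≤ L * ‖mFourierCoeff (fun x => (f₃ x : ℂ)) k‖ :=
        mul_le_mul_of_nonneg_right hk (norm_nonneg _)
      have h3 : ‖mFourierCoeff (fun x => (a x : ℂ)) k‖ ≤
          ‖mFourierCoeff (fun x => (f₁ x : ℂ)) k‖ + (1 / (2 * Real.pi) * ‖mFourierCoeff (fun x => (f₂ x : ℂ)) k‖ +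
            L * ‖mFourierCoeff (fun x => (f₃ x : ℂ)) k‖) := by
        refine hpt.trans ?_
        simp only [hf₁, hf₂, hf₃]
        linarith
      have := mul_le_mul_of_nonneg_left h3 (hr0 k)
      simp only [hu, hU₁, hU₂, hU₃]
      linarith [this]
  -- square-summability of the majorants (Bessel)
  have hsq : ∀ (f : UnitAddTorus d → ℝ), Continuous f → ∀ (t : ℝ), 0 ≤ t →
      (Summable fun k => (r k * (t * ‖mFourierCoeff (fun x => (f x : ℂ)) k‖)) ^ 2) ∧
        Real.sqrt (∑' k, (r k * (t * ‖mFourierCoeff (fun x => (f x : ℂ)) k‖)) ^ 2) ≤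
          t * Real.sqrt ((∫ x, f x ^ 2)) := by
    intro f hf t ht
    have heq : ∀ k, (r k * (t * ‖mFourierCoeff (fun x => (f x : ℂ)) k‖)) ^ 2 =
        t ^ 2 * (χ k * ‖mFourierCoeff (fun x => (f x : ℂ)) k‖ ^ 2) := fun k => by
      rw [mul_pow, mul_pow, hr2 k]; ring
    have hP := Torus.hasSum_sq_mFourierCoeff_ofReal hf
    have hs0 : Summable fun k => χ k * ‖mFourierCoeff (fun x => (f x : ℂ)) k‖ ^ 2 :=
      Summable.of_nonneg_of_le (fun k => mul_nonneg (hχ0 k) (sq_nonneg _))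
        (fun k => by nlinarith [hχ1 k, hχ0 k, sq_nonneg ‖mFourierCoeff (fun x => (f x : ℂ)) k‖]) hP.summable
    refine ⟨(hs0.mul_left (t ^ 2)).congr fun k => (heq k).symm, ?_⟩
    rw [tsum_congr heq, tsum_mul_left, Real.sqrt_mul' _ (tsum_nonneg fun k => mul_nonneg (hχ0 k) (sq_nonneg _)),
      Real.sqrt_sq ht]
    exact mul_le_mul_of_nonneg_left (Real.sqrt_le_sqrt (tsum_symbol_mul_sq_norm_mFourierCoeff_le_integral_sq hf hχ0 hχ1)) ht
  obtain ⟨hS₁, hB₁⟩ := hsq f₁ hf₁c 1 zero_le_one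
  obtain ⟨hS₂, hB₂⟩ := hsq f₂ hf₂c (1 / (2 * Real.pi)) hπ'
  obtain ⟨hS₃, hB₃⟩ := hsq f₃ hf₃c L hL
  simp only [one_mul] at hS₁ hB₁
  -- Minkowski twice
  obtain ⟨hS₂₃, hM₂₃⟩ := sqrt_tsum_add_sq_le_add hU₂0 hU₃0 hS₂ hS₃
  obtain ⟨hS, hM⟩ := sqrt_tsum_add_sq_le_add hU₁0 (fun k => add_nonneg (hU₂0 k) (hU₃0 k)) hS₁ hS₂₃
  -- compare `Σ χ‖𝓕a‖² = Σ u²` with `Σ (U₁ + U₂ + U₃)²`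
  have hu2 : ∀ k, χ k * ‖mFourierCoeff (fun x => (a x : ℂ)) k‖ ^ 2 = u k ^ 2 := fun k => by
    rw [hu]; simp only; rw [mul_pow, hr2 k]
  have hule : ∀ k, u k ^ 2 ≤ (U₁ k + (U₂ k + U₃ k)) ^ 2 := fun k => pow_le_pow_left₀ (hu0 k) (hdom k) 2
  have hsu : Summable fun k => u k ^ 2 := Summable.of_nonneg_of_le (fun k => sq_nonneg _) hule hS
  calc Real.sqrt (∑' k, χ k * ‖mFourierCoeff (fun x => (a x : ℂ)) k‖ ^ 2)
      = Real.sqrt (∑' k, u k ^ 2) := by rw [tsum_congr hu2]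
    _ ≤ Real.sqrt (∑' k, (U₁ k + (U₂ k + U₃ k)) ^ 2) := Real.sqrt_le_sqrt (hsu.tsum_le_tsum hule hS)
    _ ≤ Real.sqrt (∑' k, U₁ k ^ 2) + Real.sqrt (∑' k, (U₂ k + U₃ k) ^ 2) := hM
    _ ≤ Real.sqrt (∑' k, U₁ k ^ 2) + (Real.sqrt (∑' k, U₂ k ^ 2) + Real.sqrt (∑' k, U₃ k ^ 2)) := by gcongr
    _ ≤ Real.sqrt ((∫ x, f₁ x ^ 2)) + (1 / (2 * Real.pi) * Real.sqrt ((∫ x, f₂ x ^ 2)) +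
          L * Real.sqrt ((∫ x, f₃ x ^ 2))) := add_le_add hB₁ (add_le_add hB₂ hB₃)
    _ = _ := by ring

/-! ## §4 Producing `(a, c, p)` from a unit-circle pair (`a = sin 2πφ`, `c = cos 2πφ`: `p := (c ∂ᵢa − a ∂ᵢc)/(2π) = ∂ᵢφ`, no lift of `φ` needed) -/

/-- **The phase derivative of a unit-circle pair.**  If `a, c` are smooth real functions on `T^d` with `a² + c² = 1`, then
with `p := (c ∂ᵢa − a ∂ᵢc)/(2π)` one has `∂ᵢc = −2π p a` and `∂ᵢa = 2π p c` (differentiate `a² + c² = 1`).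
[cite: Grafakos2014, Prop. 3.2.6 (8)] -/
theorem partialDeriv_eq_of_sq_add_sq_eq_one {a c : UnitAddTorus d → ℝ} (ha : IsSmooth a) (hc : IsSmooth c)
    (h1 : ∀ x, a x ^ 2 + c x ^ 2 = 1) (i : d) (x : UnitAddTorus d) :
    partialDeriv i c x = -(2 * Real.pi) * ((c x * partialDeriv i a x - a x * partialDeriv i c x) / (2 * Real.pi) * a x) ∧
      partialDeriv i a x = (2 * Real.pi) * ((c x * partialDeriv i a x - a x * partialDeriv i c x) / (2 * Real.pi) * c x) := by
  have hπ : (2 * Real.pi) ≠ 0 := ne_of_gt (by positivity)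
  -- differentiate `a² + c² = 1`: `a ∂ᵢa + c ∂ᵢc = 0`
  have hsum : IsSmooth (fun y => a y * a y + c y * c y) := (ha.smul' ha).add (hc.smul' hc)
  have hconst : (fun y => a y * a y + c y * c y) = fun _ => (1 : ℝ) := by
    funext y; have := h1 y; simp only [sq] at this; exact this
  have hzero : partialDeriv i (fun y => a y * a y + c y * c y) x = 0 := by
    rw [hconst]
    simp [partialDeriv, Torus.lineDeriv]
  have hadd : partialDeriv i (fun y => a y * a y + c y * c y) x =
      partialDeriv i (fun y => a y * a y) x + partialDeriv i (fun y => c y * c y) x := by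
    have h := partialDeriv_add ((ha.smul' ha).isContDiff (n := 1) (by simp)) ((hc.smul' hc).isContDiff (n := 1) (by simp)) i
    simp only [smul_eq_mul] at h
    have e : (fun y => a y * a y + c y * c y) = (fun y => a y * a y) + fun y => c y * c y := rfl
    rw [e, h]; rfl
  have haa := partialDeriv_smul (ha.isContDiff (n := 1) (by simp)) (ha.isContDiff (n := 1) (by simp)) i x
  have hcc := partialDeriv_smul (hc.isContDiff (n := 1) (by simp)) (hc.isContDiff (n := 1) (by simp)) i x
  simp only [smul_eq_mul] at haa hcc
  have hrel : a x * partialDeriv i a x + c x * partialDeriv i c x = 0 := by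
    have := hzero; rw [hadd, haa, hcc] at this; linarith
  have h1x := h1 x
  constructor
  · have e : -(2 * Real.pi) * ((c x * partialDeriv i a x - a x * partialDeriv i c x) / (2 * Real.pi) * a x) =
        -((c x * partialDeriv i a x - a x * partialDeriv i c x) * a x) := by field_simp
    rw [e]
    linear_combination (c x) * hrel - (partialDeriv i c x) * h1x
  · have e : (2 * Real.pi) * ((c x * partialDeriv i a x - a x * partialDeriv i c x) / (2 * Real.pi) * c x) =
        (c x * partialDeriv i a x - a x * partialDeriv i c x) * c x := by field_simp
    rw [e]
    linear_combination (a x) * hrel - (partialDeriv i a x) * h1x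

/-- The phase derivative `(c ∂ᵢa − a ∂ᵢc)/(2π)` of a smooth pair is smooth. [cite: Grafakos2014, Prop. 3.2.6 (8)] -/
theorem isSmooth_phaseDeriv_of_pair {a c : UnitAddTorus d → ℝ} (ha : IsSmooth a) (hc : IsSmooth c) (i : d) :
    IsSmooth (fun x => (c x * partialDeriv i a x - a x * partialDeriv i c x) / (2 * Real.pi)) := by
  have h := ((hc.smul' (ha.partialDeriv i)).sub (ha.smul' (hc.partialDeriv i))).smul (1 / (2 * Real.pi))
  convert h using 1
  funext x
  simp only [Pi.smul_apply, Pi.sub_apply, smul_eq_mul]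
  ring

/-- **The band inequality for a unit-circle pair** (`a² + c² = 1`, e.g. `a = sin 2πφ`, `c = cos 2πφ`), any smooth weight `w`,
with the phase derivative `p = (c ∂ᵢa − a ∂ᵢc)/(2π)` built in: for every real symbol `0 ≤ χ ≤ 1` vanishing off `|kᵢ| ≤ L`, `0 ≤ L`,
`√(Σ' χ(k) ‖𝓕a(k)‖²) ≤ √∫((1 − w p) a)² + (2π)⁻¹ √∫(c ∂ᵢw)² + L √∫(w c)²`.
[cite: Grafakos2014, Prop. 3.2.6 (8) and Prop. 3.2.7 (3)] -/
theorem sqrt_tsum_band_sq_norm_mFourierCoeff_le_of_pair {a c w : UnitAddTorus d → ℝ} (ha : IsSmooth a)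
    (hc : IsSmooth c) (h1 : ∀ x, a x ^ 2 + c x ^ 2 = 1) (hw : IsSmooth w) (i : d) {L : ℝ} (hL : 0 ≤ L)
    {χ : (d → ℤ) → ℝ} (hχ0 : ∀ k, 0 ≤ χ k) (hχ1 : ∀ k, χ k ≤ 1) (hχL : ∀ k, L < |(k i : ℝ)| → χ k = 0) :
    Real.sqrt (∑' k, χ k * ‖mFourierCoeff (fun x => (a x : ℂ)) k‖ ^ 2) ≤
      Real.sqrt (∫ x, ((1 - w x * ((c x * partialDeriv i a x - a x * partialDeriv i c x) / (2 * Real.pi))) * a x) ^ 2) +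
        1 / (2 * Real.pi) * Real.sqrt (∫ x, (c x * partialDeriv i w x) ^ 2) +
          L * Real.sqrt (∫ x, (w x * c x) ^ 2) :=
  sqrt_tsum_band_sq_norm_mFourierCoeff_le_weighted_ibp ha hc (isSmooth_phaseDeriv_of_pair ha hc i) hw i
    (fun x => (partialDeriv_eq_of_sq_add_sq_eq_one ha hc h1 i x).1) hL hχ0 hχ1 hχL

end Literature.Analysis.Fourier

end
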